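import Literature.Geometry.Kaehler.ComplexTorusAnalyticCycleClassProduct
import Literature.Geometry.Kaehler.AnalyticSetSlices
import HarnessLib

/-!
# Slices of an analytic subset of a product torus `X₁ × X₂` by the fibres of the second projection

Layer `Literature/Geometry/Kaehler`, namespace `Literature.Geometry.Kaehler.ComplexTorus`; lane
`lit-hodgefound`, seat p07, programme «THE ANALYTIC CLASSES OF A COMPLEX TORUS FORM A RING», file 5
(files 1–4: `ComplexTorusAnalyticClassesCupProductReduction.lean`, `HolomorphicChainSheetCoarea.lean`,
`AnalyticSetSlices.lean`, `AnalyticSetAdaptedSections.lean`). For the Euclidean product torus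
`X = X₁ × X₂ = (E₁ ⊞ E₂)/(Λ₁ ⊕ Λ₂)` (`prodPeriodL2 Φ₁ Φ₂`) and `Z ⊆ X`, the SLICE over `t ∈ E₂` is
`Z_t = {x̄ ∈ X₁ | (x̄, π₂ t) ∈ Z}`; its lift to `E₁` is the slice `{x | (x, t) ∈ π⁻¹Z}` of the lift of `Z`.

* §1 the lift dictionary for pure dimension in the MODEL space (`hasPureCodim_preimage_cover`,
  `hasPureDim_preimage_cover`, and the converses `hasPureCodim_of_preimage_cover`,
  `hasPureDim_of_preimage_cover`) [Chirka1989 §2.3: `π` is a local biholomorphism];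
* §2 the carrier of the chain `[π⁻¹Z]` is the set of regular points of `π⁻¹Z`
  (`mem_carrier_analyticChain_iff_isRegPt`, `carrier_analyticChain_eq`), **the period functional is the
  plain integral** `∫_Z ω = ∫_{reg π⁻¹Z ∩ box} ω(ξ) d𝓗^{2d}` (`analyticCyclePeriod_eq_setIntegral`) with
  integrable integrand (`integrableOn_apply_orientationFrame_carrier_inter_periodBox`)
  [Chirka1989 §14.1; VoisinHodgeI2002 §11.1.2];
* §3 (`HolomorphicChain`, on `V₁ ⊞ V₂`) **the cross form `pr₁^*γ ∧ pr₂^*ν` with `ν` of top degree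
  vanishes on the orientation frame at every carrier point critical for `pr₂`**
  (`HolomorphicChain.cross_apply_orientationFrame_eq_zero_of_critical`; the frame spans the tangent space
  `ker dg(z)` by `approxTangentCone_carrier_eq_ker`, and a top-degree form kills families in a proper
  subspace, `apply_eq_zero_of_forall_mem_of_ne_top`) [Federer1969 3.2.22];
* §4 slices: `setOf_toLp_mem_preimage_cover` (the lift of `Z_t` is the slice of the lift),
  `isAnalyticSet_fibreSlice` (`Z_t` is analytic), and **generic purity** `ae_hasPureDim_fibreSlice`: if `Z`
  has pure dimension `q + dim E₂` then for Lebesgue-a.e. `t ∈ E₂` the slice `Z_t` is empty or of pure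
  dimension `q`, no regular point of `π⁻¹Z` over `t` is critical for `pr₂`, and the slice of the singular
  locus of `π⁻¹Z` over `t` is `𝓗^{2q}`-null [Chirka1989 §3.7 Cor., §4.5; Federer1969 3.2.22] — file 3's
  `ae_hasPureDim_slice` transported to the torus.

Theorems only; no definitions, no named facts.

## References

* [Chirka1989] E. M. Chirka, *Complex Analytic Sets*, Kluwer 1989, §2.3, §3.7, §4.5, §14.1.
* [VoisinHodgeI2002] C. Voisin, *Hodge Theory and Complex Algebraic Geometry I*, CUP 2002, §11.1.2.
* [Federer1969] H. Federer, *Geometric Measure Theory*, Springer 1969, 1.4.3, 3.2.22.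
-/

noncomputable section

open scoped Manifold Topology ENNReal
open MeasureTheory MeasureTheory.Measure Set Function Filter Module TopologicalSpace WithLp
open Literature.Geometry.GeometricMeasureTheory Literature.Analysis.Complex

universe u

namespace Literature.Geometry.Kaehler

namespace ComplexTorus

/-! ### §1 Pure dimension of the lift, in the model space -/

section Cover

variable {ι : Type*} [Fintype ι] {E : Type u} [NormedAddCommGroup E] [NormedSpace ℂ E]
  (Φ : (ι → ℝ) ≃L[ℝ] E)

/-- **The lift `π⁻¹Z ⊆ E` of an analytic subset of pure codimension `c` has pure codimension `c`** (as a
subset of the model space `E`). [cite: Chirka1989, §2.3, p. 29] -/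
theorem hasPureCodim_preimage_cover {Z : Set (ComplexTorus Φ)} {c : ℕ} (hZ : HasPureCodim 𝓘(ℂ, E) Z c) :
    HasPureCodim 𝓘(ℂ, E) (cover Φ ⁻¹' Z) c := by
  obtain ⟨hZa, hZne, hZreg⟩ := hZ
  refine ⟨hZa.preimage (mdifferentiable_cover Φ), ?_, fun x hx ↦ ?_⟩
  · obtain ⟨y, hy⟩ := hZne
    obtain ⟨x, rfl⟩ := cover_surjective Φ y
    exact ⟨x, hy⟩
  · -- `reg π⁻¹Z = π⁻¹ reg Z` (`regularLocus_cover_preimage`, inlined to keep the imports light)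
    have hx' : cover Φ x ∈ regularLocus 𝓘(ℂ, E) Z := by
      simpa only [regularLocus, mem_preimage, mem_setOf_eq, isRegularPointOfCodim_cover_preimage_iff]
        using hx
    exact (isRegularPointOfCodim_cover_preimage_iff Φ x).2 (hZreg _ hx')

/-- **The lift `π⁻¹Z ⊆ E` of an analytic subset of pure dimension `d` has pure dimension `d`.**
[cite: Chirka1989, §2.3, p. 29] -/
theorem hasPureDim_preimage_cover {Z : Set (ComplexTorus Φ)} {d : ℕ} (hZ : HasPureDim 𝓘(ℂ, E) Z d) :
    HasPureDim 𝓘(ℂ, E) (cover Φ ⁻¹' Z) d := by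
  obtain ⟨c, hdc, hZc⟩ := hZ
  exact ⟨c, hdc, hasPureCodim_preimage_cover Φ hZc⟩

/-- Conversely, an analytic `Z ⊆ X` whose lift has pure codimension `c` has pure codimension `c`.
[cite: Chirka1989, §2.3, p. 29] -/
theorem hasPureCodim_of_preimage_cover {Z : Set (ComplexTorus Φ)} {c : ℕ} (hZa : IsAnalyticSet 𝓘(ℂ, E) Z)
    (hZ : HasPureCodim 𝓘(ℂ, E) (cover Φ ⁻¹' Z) c) : HasPureCodim 𝓘(ℂ, E) Z c := by
  obtain ⟨-, ⟨x, hx⟩, hZreg⟩ := hZ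
  refine ⟨hZa, ⟨cover Φ x, hx⟩, fun y hy ↦ ?_⟩
  obtain ⟨x, rfl⟩ := cover_surjective Φ y
  have hx : x ∈ regularLocus 𝓘(ℂ, E) (cover Φ ⁻¹' Z) := by
    simpa only [regularLocus, mem_preimage, mem_setOf_eq, isRegularPointOfCodim_cover_preimage_iff]
      using hy
  exact (isRegularPointOfCodim_cover_preimage_iff Φ x).1 (hZreg x hx)

/-- Conversely, an analytic `Z ⊆ X` whose lift has pure dimension `d` has pure dimension `d`.
[cite: Chirka1989, §2.3, p. 29] -/
theorem hasPureDim_of_preimage_cover {Z : Set (ComplexTorus Φ)} {d : ℕ} (hZa : IsAnalyticSet 𝓘(ℂ, E) Z)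
    (hZ : HasPureDim 𝓘(ℂ, E) (cover Φ ⁻¹' Z) d) : HasPureDim 𝓘(ℂ, E) Z d := by
  obtain ⟨c, hdc, hZc⟩ := hZ
  exact ⟨c, hdc, hasPureCodim_of_preimage_cover Φ hZa hZc⟩

end Cover

/-! ### §2 The carrier of `[π⁻¹Z]` and the period functional as a set integral -/

section Carrier

variable {ι : Type*} [Fintype ι] {E : Type u} [NormedAddCommGroup E] [InnerProductSpace ℂ E]
  [FiniteDimensional ℂ E] [MeasurableSpace E] [BorelSpace E] (Φ : (ι → ℝ) ≃L[ℝ] E) {d : ℕ}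

omit [MeasurableSpace E] [BorelSpace E] in
/-- **The carrier of the chain `[π⁻¹Z]` is the set of regular points of `π⁻¹Z ⊆ E`** (model-space
form of `mem_carrier_analyticChain_iff`). [cite: Chirka1989, §14.1 Cor., p. 174] -/
theorem mem_carrier_analyticChain_iff_isRegPt {Z : Set (ComplexTorus Φ)} (hZ : HasPureDim 𝓘(ℂ, E) Z d)
    {z : E} :
    z ∈ (analyticChain Φ hZ).carrier ↔ z ∈ cover Φ ⁻¹' Z ∧ ∃ c, SCV.IsRegPt (cover Φ ⁻¹' Z) c z := by
  rw [mem_carrier_analyticChain_iff]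
  simp only [regularLocus, mem_setOf_eq, ← isRegularPointOfCodim_cover_preimage_iff,
    SCV.isRegularPointOfCodim_iff_isRegPt, mem_preimage]

omit [MeasurableSpace E] [BorelSpace E] in
/-- The carrier of `[π⁻¹Z]` is the regular locus of `π⁻¹Z` in the model space.
[cite: Chirka1989, §14.1 Cor., p. 174] -/
theorem carrier_analyticChain_eq {Z : Set (ComplexTorus Φ)} (hZ : HasPureDim 𝓘(ℂ, E) Z d) :
    (analyticChain Φ hZ).carrier = regularLocus 𝓘(ℂ, E) (cover Φ ⁻¹' Z) := by
  ext z
  rw [mem_carrier_analyticChain_iff]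
  simp only [regularLocus, mem_preimage, mem_setOf_eq, isRegularPointOfCodim_cover_preimage_iff]

omit [MeasurableSpace E] [BorelSpace E] in
/-- Points of the carrier of `[π⁻¹Z]` are regular points of `π⁻¹Z` of the top codimension `dim E - d`.
[cite: Chirka1989, §14.1 Cor., p. 174] -/
theorem isRegPt_of_mem_carrier_analyticChain {Z : Set (ComplexTorus Φ)} (hZ : HasPureDim 𝓘(ℂ, E) Z d)
    {z : E} (hz : z ∈ (analyticChain Φ hZ).carrier) :
    SCV.IsRegPt (cover Φ ⁻¹' Z) (finrank ℂ E - d) z := by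
  obtain ⟨hzA, c, hc⟩ := (mem_carrier_analyticChain_iff_isRegPt Φ hZ).1 hz
  obtain ⟨c', hdc', hA⟩ := hasPureDim_preimage_cover Φ hZ
  have hreg : z ∈ regularLocus 𝓘(ℂ, E) (cover Φ ⁻¹' Z) :=
    ⟨hzA, c, SCV.isRegularPointOfCodim_iff_isRegPt.2 hc⟩
  have h := SCV.isRegularPointOfCodim_iff_isRegPt.1 (hA.2.2 z hreg)
  rwa [show finrank ℂ E - d = c' by omega]

/-- **The period functional of `[Z]` is a plain set integral**: for `Z ⊆ X` analytic of pure dimension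
`d` and an invariant `2d`-form `ω`,
`∫_Z ω = ∫_{reg π⁻¹Z ∩ Φ([0,1)^ι)} ω(ξ(z)) d𝓗^{2d}(z)` (the density of `[π⁻¹Z]` is `1` on its carrier).
[cite: VoisinHodgeI2002, §11.1.2 Cor. 11.15; Chirka1989, §14.1 Cor., p. 174] -/
theorem analyticCyclePeriod_eq_setIntegral {Z : Set (ComplexTorus Φ)} (hZ : HasPureDim 𝓘(ℂ, E) Z d)
    (ω : E [⋀^Fin (2 * d)]→L[ℝ] ℂ) :
    analyticCyclePeriod Φ hZ ω = ∫ z in (analyticChain Φ hZ).carrier ∩ periodBox Φ 0,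
      ω ((analyticChain Φ hZ).orientationFrame z) ∂(μHE[2 * d] : Measure E) := by
  rw [show analyticCyclePeriod Φ hZ ω = (analyticChain Φ hZ).torusPeriod Φ ω from rfl,
    HolomorphicChain.torusPeriod_apply, Measure.restrict_restrict (measurableSet_periodBox Φ 0),
    inter_comm]
  refine setIntegral_congr_fun
    ((analyticChain Φ hZ).measurableSet_carrier.inter (measurableSet_periodBox Φ 0)) fun z hz ↦ ?_
  rw [show (analyticChain Φ hZ).density z = 1 from HolomorphicChain.density_ofSet_of_mem_carrier _ hz.1]
  simp

/-- **The integrand of the period functional is integrable**: `z ↦ ω(ξ(z))` is `𝓗^{2d}`-integrable on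
`reg π⁻¹Z ∩ Φ([0,1)^ι)` (Lelong's bound on a compact box). [cite: VoisinHodgeI2002, §11.1.2 Cor. 11.15;
Chirka1989, §14.1 Cor., p. 174] -/
theorem integrableOn_apply_orientationFrame_carrier_inter_periodBox {Z : Set (ComplexTorus Φ)}
    (hZ : HasPureDim 𝓘(ℂ, E) Z d) (ω : E [⋀^Fin (2 * d)]→L[ℝ] ℂ) :
    IntegrableOn (fun z ↦ ω ((analyticChain Φ hZ).orientationFrame z))
      ((analyticChain Φ hZ).carrier ∩ periodBox Φ 0) (μHE[2 * d] : Measure E) := by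
  have h := (analyticChain Φ hZ).integrableOn_constIntegrand
    ((analyticChain Φ hZ).integrableOn_density_smul_frameVector_periodBox Φ 0) ω
  rw [IntegrableOn, Measure.restrict_restrict (measurableSet_periodBox Φ 0), inter_comm] at h
  refine IntegrableOn.congr_fun h (fun z hz ↦ ?_)
    ((analyticChain Φ hZ).measurableSet_carrier.inter (measurableSet_periodBox Φ 0))
  rw [show (analyticChain Φ hZ).density z = 1 from HolomorphicChain.density_ofSet_of_mem_carrier _ hz.1]
  simp

end Carrier

end ComplexTorus

/-! ### §3 The cross form vanishes on the tangent spaces critical for the second projection -/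

section Critical

variable {V₁ V₂ : Type*} [NormedAddCommGroup V₁] [InnerProductSpace ℂ V₁] [FiniteDimensional ℂ V₁]
  [NormedAddCommGroup V₂] [InnerProductSpace ℂ V₂] [FiniteDimensional ℂ V₂]

/-- **A top-degree form kills every family lying in a proper subspace**: if `dim_ℂ V₂ = b` and the `2b`
vectors `x j` lie in a proper real subspace `S ⊊ V₂`, then `ν(x) = 0` for every real-multilinear
alternating `2b`-form `ν` (the family is linearly dependent). [cite: Federer1969, 1.4.3 (alternating
forms vanish on dependent families)] -/
theorem apply_eq_zero_of_forall_mem_of_ne_top {b : ℕ} (ν : V₂ [⋀^Fin (2 * b)]→L[ℝ] ℂ)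
    (hb : finrank ℂ V₂ = b) {S : Submodule ℝ V₂} (hS : S ≠ ⊤) {x : Fin (2 * b) → V₂}
    (hx : ∀ j, x j ∈ S) : ν x = 0 := by
  have hnot : ¬ LinearIndependent ℝ x := by
    intro hli
    haveI : FiniteDimensional ℝ V₂ := FiniteDimensional.complexToReal V₂
    have hcard : Fintype.card (Fin (2 * b)) = finrank ℝ V₂ := by
      rw [Fintype.card_fin, finrank_real_of_complex, hb]
    have htop := hli.span_eq_top_of_card_eq_finrank' hcard
    apply hS
    rw [eq_top_iff, ← htop, Submodule.span_le]
    rintro _ ⟨j, rfl⟩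
    exact hx j
  exact ν.toAlternatingMap.map_linearDependent x hnot

variable [MeasurableSpace (WithLp 2 (V₁ × V₂))] [BorelSpace (WithLp 2 (V₁ × V₂))]
  {Ω' : Opens (WithLp 2 (V₁ × V₂))} {p a b : ℕ}

/-- **The cross form `pr₁^*γ ∧ pr₂^*ν` (with `ν` of top degree `2 dim V₂`) vanishes on the orientation
frame of a holomorphic `p`-chain at every carrier point which is CRITICAL for `pr₂`**: if near
`z ∈ reg|T|` the carrier lies in a level set of a holomorphic `g : V₁ ⊞ V₂ → ℂᶜ` with `dg(z)` onto and
`dim ker dg(z) = p`, and `ker dg(z)` does NOT project onto `V₂`, then the frame vectors `ξ_T(z)_i` lie in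
`ker dg(z)` (the approximate tangent space, `approxTangentCone_carrier_eq_ker`), so in every shuffle term
the `2 dim V₂` arguments of `ν` lie in the proper real subspace `pr₂(ker dg(z))` and the term vanishes.
[cite: Federer1969, 3.2.22 (the coarea factor vanishes where the tangent map is not onto); Chirka1989,
§14.1 Cor., p. 174] -/
theorem HolomorphicChain.cross_apply_orientationFrame_eq_zero_of_critical
    (T : HolomorphicChain 𝓘(ℂ, WithLp 2 (V₁ × V₂)) Ω' p) (h2 : 2 * a + 2 * b = 2 * p)
    (hb : finrank ℂ V₂ = b) {z : WithLp 2 (V₁ × V₂)} (hz : z ∈ T.carrier) {N : Set (WithLp 2 (V₁ × V₂))}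
    (hN : N ∈ 𝓝 z) {c : ℕ} {g : WithLp 2 (V₁ × V₂) → (Fin c → ℂ)} (hg : DifferentiableAt ℂ g z)
    (hgN : ∀ z' ∈ T.carrier ∩ N, g z' = g z) (hsurj : Surjective (fderiv ℂ g z))
    (hpc : finrank ℂ (WithLp 2 (V₁ × V₂)) = p + c)
    (hcrit : ¬ ∀ v : V₂, ∃ u : WithLp 2 (V₁ × V₂), fderiv ℂ g z u = 0 ∧ (ofLp u).2 = v)
    (γ : V₁ [⋀^Fin (2 * a)]→L[ℝ] ℂ) (ν : V₂ [⋀^Fin (2 * b)]→L[ℝ] ℂ) :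
    ((((γ.compContinuousLinearMap (ContinuousLinearMap.fst ℝ V₁ V₂)).wedge
          (ν.compContinuousLinearMap (ContinuousLinearMap.snd ℝ V₁ V₂))).domDomCongr
        (finCongr h2)).compContinuousLinearMap
      (WithLp.prodContinuousLinearEquiv 2 ℝ V₁ V₂ :
        WithLp 2 (V₁ × V₂) →L[ℝ] V₁ × V₂)) (T.orientationFrame z) = 0 := by
  classical
  set L : WithLp 2 (V₁ × V₂) →L[ℝ] (Fin c → ℂ) := (fderiv ℂ g z).restrictScalars ℝ with hLdef
  have hLa : ∀ u, L u = fderiv ℂ g z u := fun u ↦ rfl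
  have hL : HasFDerivAt g L z := hg.hasFDerivAt.restrictScalars ℝ
  -- `ker_ℝ dg(z)` has real dimension `2p`
  have hkerC : finrank ℂ (LinearMap.ker (fderiv ℂ g z : WithLp 2 (V₁ × V₂) →ₗ[ℂ] (Fin c → ℂ))) = p := by
    have h := LinearMap.finrank_range_add_finrank_ker
      (fderiv ℂ g z : WithLp 2 (V₁ × V₂) →ₗ[ℂ] (Fin c → ℂ))
    rw [LinearMap.range_eq_top.2 hsurj, finrank_top, Module.finrank_fin_fun, hpc] at h
    omega
  have hkereq : LinearMap.ker (L : WithLp 2 (V₁ × V₂) →ₗ[ℝ] (Fin c → ℂ)) =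
      (LinearMap.ker (fderiv ℂ g z : WithLp 2 (V₁ × V₂) →ₗ[ℂ] (Fin c → ℂ))).restrictScalars ℝ := by
    ext u
    simp only [LinearMap.mem_ker, Submodule.restrictScalars_mem, ContinuousLinearMap.coe_coe, hLa]
  have hker : finrank ℝ (LinearMap.ker (L : WithLp 2 (V₁ × V₂) →ₗ[ℝ] (Fin c → ℂ))) = 2 * p := by
    rw [hkereq]
    change finrank ℝ (LinearMap.ker (fderiv ℂ g z : WithLp 2 (V₁ × V₂) →ₗ[ℂ] (Fin c → ℂ))) = 2 * p
    rw [finrank_real_of_complex, hkerC]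
  -- the frame vectors lie in `ker dg(z)`
  have hcone := T.approxTangentCone_carrier_eq_ker hz hN hL hgN hker
  have hspan := (T.orientationFrame_orthonormal_span_eq hz).2
  have hmem : ∀ i, fderiv ℂ g z (T.orientationFrame z i) = 0 := fun i ↦ by
    have hi : T.orientationFrame z i ∈
        (LinearMap.ker (L : WithLp 2 (V₁ × V₂) →ₗ[ℝ] (Fin c → ℂ)) : Set (WithLp 2 (V₁ × V₂))) := by
      rw [← hcone, ← hspan]
      exact Submodule.subset_span (mem_range_self i)
    exact hi
  -- the proper real subspace `pr₂ (ker dg(z))`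
  set P₂ : WithLp 2 (V₁ × V₂) →ₗ[ℝ] V₂ :=
    (LinearMap.snd ℝ V₁ V₂).comp
      (WithLp.linearEquiv 2 ℝ (V₁ × V₂) : WithLp 2 (V₁ × V₂) →ₗ[ℝ] V₁ × V₂) with hP₂
  have hP₂a : ∀ u, P₂ u = (ofLp u).2 := fun u ↦ rfl
  set S : Submodule ℝ V₂ := (LinearMap.ker (L : WithLp 2 (V₁ × V₂) →ₗ[ℝ] (Fin c → ℂ))).map P₂ with hSdef
  have hS : S ≠ ⊤ := by
    intro hS
    apply hcrit
    intro v
    have hv : v ∈ S := hS ▸ Submodule.mem_top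
    obtain ⟨u, hu, rfl⟩ := Submodule.mem_map.1 hv
    exact ⟨u, hu, (hP₂a u).symm ▸ rfl⟩
  have hξS : ∀ i, (ofLp (T.orientationFrame z i)).2 ∈ S := fun i ↦
    Submodule.mem_map.2 ⟨_, hmem i, hP₂a _⟩
  -- expand the shuffle formula; every `ν`-factor vanishes
  rw [ContinuousAlternatingMap.compContinuousLinearMap_apply, ContinuousAlternatingMap.domDomCongr_apply,
    ContinuousAlternatingMap.wedge_apply]
  refine smul_eq_zero_of_right _ (Finset.sum_eq_zero fun σ _ ↦ ?_)
  have hν : (ν.compContinuousLinearMap (ContinuousLinearMap.snd ℝ V₁ V₂)) (fun j ↦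
      ((⇑(WithLp.prodContinuousLinearEquiv 2 ℝ V₁ V₂ : WithLp 2 (V₁ × V₂) →L[ℝ] V₁ × V₂) ∘
          T.orientationFrame z) ∘ ⇑(finCongr h2))
        (σ (Fin.natAdd (2 * a) j))) = 0 := by
    rw [ContinuousAlternatingMap.compContinuousLinearMap_apply]
    exact apply_eq_zero_of_forall_mem_of_ne_top ν hb hS fun j ↦ hξS _
  rw [hν, mul_zero, smul_zero]

end Critical

namespace ComplexTorus

/-! ### §4 Slices over the second factor -/

section Slices

variable {ι₁ ι₂ : Type*} [Fintype ι₁] [Fintype ι₂]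
  {E₁ : Type u} [NormedAddCommGroup E₁] [InnerProductSpace ℂ E₁] [FiniteDimensional ℂ E₁]
  [MeasurableSpace E₁] [BorelSpace E₁]
  {E₂ : Type u} [NormedAddCommGroup E₂] [InnerProductSpace ℂ E₂] [FiniteDimensional ℂ E₂]
  [MeasurableSpace E₂] [BorelSpace E₂]
  (Φ₁ : (ι₁ → ℝ) ≃L[ℝ] E₁) (Φ₂ : (ι₂ → ℝ) ≃L[ℝ] E₂)

omit [FiniteDimensional ℂ E₁] [MeasurableSpace E₁] [BorelSpace E₁] [FiniteDimensional ℂ E₂]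
  [MeasurableSpace E₂] [BorelSpace E₂] in
/-- **The lift of the slice `Z_t = {x̄ | (x̄, π₂ t) ∈ Z}` is the slice of the lift**:
`{x | (x, t) ∈ π⁻¹Z} = π₁⁻¹(Z_t)`. [cite: LangeBirkenhake1992, §5.3] -/
theorem setOf_toLp_mem_preimage_cover (Z : Set (ComplexTorus (prodPeriodL2 Φ₁ Φ₂))) (t : E₂) :
    {x : E₁ | toLp 2 (x, t) ∈ cover (prodPeriodL2 Φ₁ Φ₂) ⁻¹' Z} =
      cover Φ₁ ⁻¹' {x | (prodHomeomorphL2 Φ₁ Φ₂).symm (x, cover Φ₂ t) ∈ Z} := by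
  ext x
  simp only [mem_setOf_eq, mem_preimage]
  rw [← (prodHomeomorphL2 Φ₁ Φ₂).symm_apply_apply (cover (prodPeriodL2 Φ₁ Φ₂) (toLp 2 (x, t))),
    prodHomeomorphL2_cover]

omit [FiniteDimensional ℂ E₁] [MeasurableSpace E₁] [BorelSpace E₁] [FiniteDimensional ℂ E₂]
  [MeasurableSpace E₂] [BorelSpace E₂] in
/-- **Slices of analytic subsets of `X₁ × X₂` are analytic**: `Z_t = {x̄ | (x̄, π₂ t) ∈ Z}` is the
preimage of `Z` under the holomorphic map `x̄ ↦ (x̄, π₂ t)`. [cite: Chirka1989, §2.1, p. 18] -/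
theorem isAnalyticSet_fibreSlice {Z : Set (ComplexTorus (prodPeriodL2 Φ₁ Φ₂))}
    (hZ : IsAnalyticSet 𝓘(ℂ, WithLp 2 (E₁ × E₂)) Z) (y : ComplexTorus Φ₂) :
    IsAnalyticSet 𝓘(ℂ, E₁) {x : ComplexTorus Φ₁ | (prodHomeomorphL2 Φ₁ Φ₂).symm (x, y) ∈ Z} := by
  have hf : MDifferentiable 𝓘(ℂ, E₁) 𝓘(ℂ, WithLp 2 (E₁ × E₂))
      (fun x : ComplexTorus Φ₁ ↦ (prodHomeomorphL2 Φ₁ Φ₂).symm (x, y)) :=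
    (mdifferentiable_prodHomeomorphL2_symm Φ₁ Φ₂).comp (mdifferentiable_id.prodMk mdifferentiable_const)
  exact hZ.preimage hf

/-- **Generic purity of the slices of an analytic subset of `X₁ × X₂`.** Let `Z ⊆ X₁ × X₂` be analytic
of pure dimension `q + dim E₂`. Then for Lebesgue-a.e. `t ∈ E₂` (any additive Haar measure `μ`):
(i) no regular point of the lift `π⁻¹Z ⊆ E₁ ⊞ E₂` over `t` is critical for `pr₂` (every regular point
`z` with `pr₂ z = t` has a local equation `g` with `dg(z)` onto and `ker dg(z)` projecting onto `E₂`);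
(ii) the slice over `t` of the singular locus of `π⁻¹Z` is `𝓗^{2q}`-null; (iii) the slice
`Z_t = {x̄ | (x̄, π₂ t) ∈ Z}` is EMPTY or of PURE DIMENSION `q`.
[cite: Chirka1989, §3.7 Cor., p. 44; §4.5, p. 56; Federer1969, 3.2.22] -/
theorem ae_hasPureDim_fibreSlice (μ : Measure E₂) [μ.IsAddHaarMeasure]
    {Z : Set (ComplexTorus (prodPeriodL2 Φ₁ Φ₂))} {q : ℕ}
    (hZ : HasPureDim 𝓘(ℂ, WithLp 2 (E₁ × E₂)) Z (q + finrank ℂ E₂)) :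
    ∀ᵐ t ∂μ,
      t ∉ (fun z : WithLp 2 (E₁ × E₂) ↦ (ofLp z).2) ''
          {z | z ∈ cover (prodPeriodL2 Φ₁ Φ₂) ⁻¹' Z ∧
            (∃ c, SCV.IsRegPt (cover (prodPeriodL2 Φ₁ Φ₂) ⁻¹' Z) c z) ∧
            ¬ ∃ (U : Set (WithLp 2 (E₁ × E₂))) (c : ℕ) (g : WithLp 2 (E₁ × E₂) → (Fin c → ℂ)),
                IsOpen U ∧ z ∈ U ∧ DifferentiableOn ℂ g U ∧
                cover (prodPeriodL2 Φ₁ Φ₂) ⁻¹' Z ∩ U = U ∩ g ⁻¹' {0} ∧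
                Surjective (fderiv ℂ g z) ∧
                ∀ v : E₂, ∃ u : WithLp 2 (E₁ × E₂), fderiv ℂ g z u = 0 ∧ (ofLp u).2 = v} ∧
      μH[((2 * q : ℕ) : ℝ)]
          {x : E₁ | toLp 2 (x, t) ∈
            singularLocus 𝓘(ℂ, WithLp 2 (E₁ × E₂)) (cover (prodPeriodL2 Φ₁ Φ₂) ⁻¹' Z)} = 0 ∧
      ({x : ComplexTorus Φ₁ | (prodHomeomorphL2 Φ₁ Φ₂).symm (x, cover Φ₂ t) ∈ Z} = ∅ ∨
        HasPureDim 𝓘(ℂ, E₁) {x : ComplexTorus Φ₁ | (prodHomeomorphL2 Φ₁ Φ₂).symm (x, cover Φ₂ t) ∈ Z} q) := by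
  have hA := hasPureDim_preimage_cover (prodPeriodL2 Φ₁ Φ₂) hZ
  have hZa : IsAnalyticSet 𝓘(ℂ, WithLp 2 (E₁ × E₂)) Z := hZ.isAnalyticSet
  filter_upwards [ae_hasPureDim_slice μ hA rfl] with t ht
  refine ⟨ht.1, ht.2.1, ?_⟩
  have hslice := setOf_toLp_mem_preimage_cover Φ₁ Φ₂ Z t
  rcases ht.2.2 with h | h
  · left
    rw [hslice] at h
    apply eq_empty_of_forall_notMem
    intro y hy
    obtain ⟨x, rfl⟩ := cover_surjective Φ₁ y
    have : x ∈ (∅ : Set E₁) := h ▸ (show x ∈ cover Φ₁ ⁻¹' _ from hy)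
    exact this
  · right
    rw [hslice] at h
    exact hasPureDim_of_preimage_cover Φ₁ (isAnalyticSet_fibreSlice Φ₁ Φ₂ hZa (cover Φ₂ t)) h

end Slices

end ComplexTorus

end Literature.Geometry.Kaehler

end
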